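import Mathlib
import Literature.RingTheory.CohomologyAnnihilator.Basic
import Literature.RingTheory.CohomologyAnnihilator.StableAnnihilation
import Literature.RingTheory.CohomologyAnnihilator.NoetherDifferentAnnihilator
import Literature.RingTheory.CohomologyAnnihilator.SyzygyBasic
import Literature.RingTheory.CohomologyAnnihilator.SyzygyDescent
import Literature.RingTheory.CohomologyAnnihilator.StrongGenerator
import Summits.ResolutionOfSingularities.ResolutionOfSingularities.Theorems.HomologicalConductorNoZenoReflexiveSyzygy
import Summits.ResolutionOfSingularities.ResolutionOfSingularities.Theorems.HomologicalConductorPersistenceConductorCeiling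
import Summits.ResolutionOfSingularities.ResolutionOfSingularities.Theorems.HomologicalConductorPersistenceRecurrenceExclusion
import Summits.ResolutionOfSingularities.ResolutionOfSingularities.Theorems.HomologicalConductorPersistencePeriodicSaturationStage
import HarnessLib

/-!
# Rung S-2 `PersistenceSurface` (stmt-ResolutionOfSingularities-19970), stub C1 `SaturationFourSurfaceResidual₄`:
# over a noetherian DOMAIN the levels `ca³ ⊆ ca⁴ ⊆ …` of the cohomology annihilator are computed on
# REFLEXIVE modules, and `Sat₄` is the retract property of FIRST SYZYGIES OF REFLEXIVE MODULES

Route `ResolutionOfSingularities/HomologicalConductor`, chain W4.4b, rung S-2 `PersistenceSurface`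
(stmt-ResolutionOfSingularities-19970), registered skeleton 1a77c002, stub
`stub_saturationFourSurfaceResidualFour : SaturationFourSurfaceResidual₄` (`ca(T_m) ⊆ ca⁴(T_m)` at the residual
two-dimensional stages).  [OURS · pure module theory over LANDED tree lemmas; AI-written, weaker than expert review;
NOT a statement of the manuscript under study (Hironaka 2017) and no statement of that manuscript is used.]
DEF-FREE: no new `def`, no conjecture, no named fact.

WHAT THIS FILE PINS DOWN.  Every stage `T_m`, `m ≥ 1`, of the canonical `ca`-tower is a noetherian NORMAL domain of
Krull dimension `≤ 2`, so its maximal Cohen–Macaulay modules are exactly the finitely generated reflexive modules;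
but only «noetherian domain» is used below.  Over a noetherian domain `T` the two tree facts
«second syzygy modules are reflexive» (W4.4 CA0, `NoZeno.SandwichCluster.isReflexive_of_isSyzygy_two`) and
«finitely generated reflexive modules are second syzygy modules» (`PersistenceConductorCeiling.exists_isSyzygy_two_of_isReflexive`)
say that `Ω²(mod T)` IS the class `Ref(T)` of finitely generated reflexive modules.  Consequently:

* `exists_reflexive_of_isSyzygy_add_two` / `exists_isSyzygy_add_two_of_isReflexive` — an `(n+2)`-th syzygy module of
  a finitely generated module is an `n`-th syzygy module of a finitely generated REFLEXIVE module, and conversely;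
* **`mem_cohomologyAnnihilatorOfDegree_add_three_iff_forall_reflexive`** — `c ∈ caⁿ⁺³(T)` iff `c` stably
  annihilates every `n`-th syzygy module of every finitely generated reflexive module (CA1 two levels down);
  **`mem_cohomologyAnnihilatorOfDegree_add_three_iff_forall_reflexive_ext`** — iff `c • Extⁱ_T(X, N) = 0` for all
  finitely generated reflexive `X`, finitely generated `N` and `i ≥ n + 1`.  Levels of the route:
  `ca³(T) = ⋂_{X ∈ Ref} ann Ext^{≥1}(X, −)` (`…_three_iff_…`), `ca⁴(T) = ⋂_{X ∈ Ref} ann Ext^{≥2}(X, −)`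
  = the stable annihilator of the FIRST SYZYGIES `ΩX`, `X ∈ Ref(T)` (`…_four_iff_…`);
* **`cohomologyAnnihilator_eq_four_of_forall_reflexive_syzygy_retract`** — `Sat₄` CRITERION IN REFLEXIVE LANGUAGE:
  if every first syzygy `ΩX` of a finitely generated reflexive `X` is a retract of a second syzygy `Ω²X'` of a
  finitely generated reflexive `X'`, then `ca(T) = ca⁴(T)` (the tree's one-level retract criterion
  `RecurrenceExclusion.cohomologyAnnihilator_eq_of_forall_isSyzygy_retract_at` at `d = 3`, rewritten through the two
  bullets above); levelled form `cohomologyAnnihilatorOfDegree_eq_four_of_forall_reflexive_syzygy_retract`;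
* **`cohomologyAnnihilator_eq_four_of_reflexiveSyzygyClass`** — the «SPECIAL-CLASS DOOR»: if a class `𝒮` of finitely
  generated modules (a bound predicate, no definition) receives as retracts every first syzygy of every finitely
  generated reflexive module and each member of `𝒮` is a retract of a first syzygy of a member, then
  `ca(T) = ca⁴(T)`.  This is the abstract shape of the Iyama–Wemyss / Iyama–Kalck–Wemyss–Yang mechanism at a
  RATIONAL surface stage (`𝒮` = special Cohen–Macaulay modules: `Ω CM = SCM` and every special module is, up to
  free summands, a first syzygy of a special module) — cited as MOTIVATION ONLY; neither statement is used or
  asserted here;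
* `le_cohomologyAnnihilatorOfDegree_of_ca_subset_caAt`, **`ca_subset_caAt_four_iff_forall_reflexive`** — ROUTE
  VOCABULARY: for a subalgebra stage `T ⊆ K` with `↥T` noetherian, the `m`-th conjunct `ca T ⊆ caAt 4 T` of
  `SaturationFourSurfaceResidual₄` (inline sets VERBATIM) is EQUIVALENT to «every `c ∈ ca(↥T)` kills
  `Ext^{≥2}_{↥T}(X, N)` for all finitely generated reflexive `X` and finitely generated `N`», i.e. to «`ca(↥T)` stably
  annihilates `ΩX` for every finitely generated reflexive `X`».

NET for the fourth residual (C1): at every stage `T_m` the conjecture is a statement about ONE class of modules — the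
first syzygies of the finitely generated reflexive (`=` MCM at normal surface stages) modules — and the
special-class door is the typed slot a proof on the rational non-toric class would fill.  Nothing is asserted about
which stages satisfy the criterion.

References (mechanism / motivation only, nothing used as a premise): S. B. Iyengar, R. Takahashi, *Annihilation of
cohomology and strong generation of module categories*, IMRN 2016, §2 [`IyengarTakahashi2014`]; W. Bruns,
J. Herzog, *Cohen–Macaulay rings*, Prop. 1.4.1 [`BrunsHerzog1998`]; O. Iyama, M. Wemyss, *The classification of
special Cohen–Macaulay modules*, Math. Z. 265 (2010); O. Iyama, M. Kalck, M. Wemyss, D. Yang, *Frobenius categories,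
Gorenstein algebras and rational surface singularities*, Compos. Math. 151 (2015), arXiv:1209.4215.
-/

noncomputable section

-- single-problem summit: the doubled namespace component `ResolutionOfSingularities` is forced
set_option linter.dupNamespace false

namespace Summit.ResolutionOfSingularities.ResolutionOfSingularities.Theorems.HomologicalConductor.PersistenceSurfaceSaturationReflexiveSyzygy

open CategoryTheory CategoryTheory.Abelian Literature.RingTheory.CohomologyAnnihilator
open Summit.ResolutionOfSingularities.ResolutionOfSingularities.Theorems.NoZeno.SandwichCluster
open Summit.ResolutionOfSingularities.ResolutionOfSingularities.Theorems.HomologicalConductor.PersistenceConductorCeiling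
  (exists_isSyzygy_two_of_isReflexive)
open Summit.ResolutionOfSingularities.ResolutionOfSingularities.Theorems.HomologicalConductor.RecurrenceExclusion
  (exists_retract_isSyzygy_of_recurrent cohomologyAnnihilator_eq_of_forall_isSyzygy_retract_at
    cohomologyAnnihilatorOfDegree_eq_of_forall_isSyzygy_retract_at)
open Summit.ResolutionOfSingularities.ResolutionOfSingularities.Theorems.HomologicalConductor.CompletionAscentSyzygyRetract
  (StablyAnnihilates.of_retract)
open Summit.ResolutionOfSingularities.ResolutionOfSingularities.Theorems.HomologicalConductor.PeriodicSaturationStage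
  (ca_subset_caAt_of_le)

universe u

variable {T : Type u} [CommRing T]

/-! ## `Ω²(mod T) = Ref(T)` in `IsSyzygy` currency -/

/-- **An `(n+2)`-th syzygy module of a finitely generated module is an `n`-th syzygy module of a finitely
generated REFLEXIVE module** (namely of the intermediate second syzygy, which is reflexive by CA0
`isReflexive_of_isSyzygy_two` — over any domain — and finitely generated over a noetherian ring).
[cite: BrunsHerzog1998, Prop. 1.4.1] -/
theorem exists_reflexive_of_isSyzygy_add_two [IsDomain T] [IsNoetherianRing T] {n : ℕ}
    {M K : ModuleCat.{u} T} (hM : Module.Finite T M) (hK : IsSyzygy (n + 2) M K) :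
    ∃ X : ModuleCat.{u} T, Module.Finite T X ∧ Module.IsReflexive T X ∧ IsSyzygy 2 M X ∧
      IsSyzygy n X K := by
  obtain ⟨M₁, h₁, hK₁⟩ := isSyzygy_succ_iff_exists_first.mp hK
  obtain ⟨M₂, h₂, hK₂⟩ := isSyzygy_succ_iff_exists_first.mp hK₁
  have h2 : IsSyzygy 2 M M₂ := h₁.trans h₂
  exact ⟨M₂, finite_of_isSyzygy 2 hM h2, isReflexive_of_isSyzygy_two M M₂ h2, h2, hK₂⟩

/-- **An `n`-th syzygy module of a finitely generated reflexive module is an `(n+2)`-th syzygy module of a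
finitely generated module** (`X ≅ X**` is a second syzygy of a finitely generated module,
`exists_isSyzygy_two_of_isReflexive`; compose the chains). [cite: BrunsHerzog1998, Prop. 1.4.1] -/
theorem exists_isSyzygy_add_two_of_isReflexive [IsNoetherianRing T] {n : ℕ} {X K : ModuleCat.{u} T}
    [Module.Finite T X] [Module.IsReflexive T X] (hK : IsSyzygy n X K) :
    ∃ M : ModuleCat.{u} T, Module.Finite T M ∧ IsSyzygy (n + 2) M K := by
  obtain ⟨M, hM, h2⟩ := exists_isSyzygy_two_of_isReflexive (A := T) X
  exact ⟨M, hM, h2.trans hK⟩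

/-! ## The levels `caⁿ⁺³(T)` on reflexive modules -/

/-- **`caⁿ⁺³(T)` is the stable annihilator of the `n`-th syzygies of the finitely generated reflexive
modules** (noetherian domain `T`): CA1 (`mem_cohomologyAnnihilatorOfDegree_succ_iff_forall_isSyzygy`, level
`n + 2`) rewritten through `Ω²(mod T) = Ref(T)`.  For `n = 0`: `ca³(T) = ⋂_{X ∈ Ref} s̲ann(X)`; for `n = 1`:
`ca⁴(T) = ⋂_{X ∈ Ref} s̲ann(ΩX)`. [cite: IyengarTakahashi2014, Remark 2.13] -/
theorem mem_cohomologyAnnihilatorOfDegree_add_three_iff_forall_reflexive [IsDomain T] [IsNoetherianRing T]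
    (n : ℕ) (c : T) :
    c ∈ cohomologyAnnihilatorOfDegree T (n + 3) ↔
      ∀ (X K : ModuleCat.{u} T), Module.Finite T X → Module.IsReflexive T X → IsSyzygy n X K →
        StablyAnnihilates T c K := by
  rw [show n + 3 = (n + 2) + 1 from rfl, mem_cohomologyAnnihilatorOfDegree_succ_iff_forall_isSyzygy]
  constructor
  · intro h X K hX hXr hK
    haveI := hX
    haveI := hXr
    obtain ⟨M, hM, hK'⟩ := exists_isSyzygy_add_two_of_isReflexive hK
    exact h M K hM hK'
  · intro h M K hM hK
    obtain ⟨X, hX, hXr, -, hK'⟩ := exists_reflexive_of_isSyzygy_add_two hM hK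
    exact h X K hX hXr hK'

/-- **`caⁿ⁺³(T)` in `Ext` form on reflexive modules** (noetherian domain `T`): `c ∈ caⁿ⁺³(T)` iff
`c • Extⁱ_T(X, N) = 0` for every finitely generated reflexive `X`, every finitely generated `N` and every
`i ≥ n + 1`.  `⇒`: `X = Ω²Y` for a finitely generated `Y` and the connecting maps
`Extⁱ(X, N) ↪ Extⁱ⁺¹(ΩY, N) ↪ Extⁱ⁺²(Y, N)` are injective for `i ≥ 1` (injective dimension shifting,
`smul_ext_eq_zero_of_shortExact_of_projective`); `⇐`: `Extⁱ⁺²(M, N) = Extⁱ(Ω²M, N)` with `Ω²M` reflexive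
(surjective dimension shifting, `ext_smul_eq_zero_of_isSyzygy_of_forall`). [cite: IyengarTakahashi2014, Remark 2.3] -/
theorem mem_cohomologyAnnihilatorOfDegree_add_three_iff_forall_reflexive_ext [IsDomain T] [IsNoetherianRing T]
    (n : ℕ) (c : T) :
    c ∈ cohomologyAnnihilatorOfDegree T (n + 3) ↔
      ∀ X : ModuleCat.{u} T, Module.Finite T X → Module.IsReflexive T X →
        ∀ N : ModuleCat.{u} T, Module.Finite T N →
          ∀ i : ℕ, n + 1 ≤ i → ∀ e : Ext.{u} X N i, c • e = 0 := by
  constructor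
  · intro hc X hX hXr N hN i hi e
    haveI := hX
    haveI := hXr
    haveI := hN
    obtain ⟨Y, hY, h2⟩ := exists_isSyzygy_two_of_isReflexive (A := T) X
    haveI := hY
    -- unfold the two syzygy sequences `0 → X → P → X₁ → 0`, `0 → X₁ → P₁ → Y → 0`
    obtain ⟨X₁, P, h1, hPfin, hPproj, f, g, w, hS⟩ := h2
    obtain ⟨P₁, hP₁fin, hP₁proj, f₁, g₁, w₁, hS₁⟩ := isSyzygy_one_iff.mp h1
    haveI : Projective (ShortComplex.mk f g w).X₂ := hPproj
    haveI : Projective (ShortComplex.mk f₁ g₁ w₁).X₂ := hP₁proj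
    have hn1 : 1 ≤ i := le_trans (Nat.le_add_left 1 n) hi
    -- `c` kills `Extⁱ⁺²(Y, N)` (level `n + 3 ≤ i + 2`), hence `Extⁱ⁺¹(X₁, N)`, hence `Extⁱ(X, N)`
    have hY' : ∀ e' : Ext.{u} Y N (i + 1 + 1), c • e' = 0 := fun e' =>
      (mem_cohomologyAnnihilatorOfDegree_iff.mp hc) (i + 1 + 1) (by omega) Y N hY hN e'
    have hX₁ : ∀ e' : Ext.{u} X₁ N (i + 1), c • e' = 0 := fun e' =>
      smul_ext_eq_zero_of_shortExact_of_projective hS₁ (Nat.le_add_left 1 i) hY' e'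
    exact smul_ext_eq_zero_of_shortExact_of_projective hS hn1 hX₁ e
  · intro h
    rw [mem_cohomologyAnnihilatorOfDegree_iff]
    intro m hm M N hM hN e
    haveI := hM
    obtain ⟨K, hKfin, hK⟩ := exists_isSyzygy M 2
    have hKr : Module.IsReflexive T K := isReflexive_of_isSyzygy_two M K hK
    obtain ⟨i, rfl⟩ : ∃ i, m = i + 2 := ⟨m - 2, by omega⟩
    exact ext_smul_eq_zero_of_isSyzygy_of_forall 2 hK
      (fun N' hN' e' => h K hKfin hKr N' hN' i (by omega) e') N hN e

/-- **Level three**: over a noetherian domain, `c ∈ ca³(T)` iff `c • Ext^{≥1}_T(X, −) = 0` on finitely generated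
modules for every finitely generated REFLEXIVE `X` — iff `c` stably annihilates every finitely generated
reflexive module. [cite: IyengarTakahashi2014, Remark 2.13] -/
theorem mem_cohomologyAnnihilatorOfDegree_three_iff_forall_reflexive [IsDomain T] [IsNoetherianRing T]
    (c : T) :
    c ∈ cohomologyAnnihilatorOfDegree T 3 ↔
      ∀ X : ModuleCat.{u} T, Module.Finite T X → Module.IsReflexive T X → StablyAnnihilates T c X := by
  rw [mem_cohomologyAnnihilatorOfDegree_add_three_iff_forall_reflexive 0 c]
  constructor
  · intro h X hX hXr
    exact h X X hX hXr ⟨Iso.refl X⟩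
  · rintro h X K hX hXr ⟨e⟩
    exact (h X hX hXr).of_iso e.symm

/-- **Level four — the level of stub C1**: over a noetherian domain, `c ∈ ca⁴(T)` iff
`c • Extⁱ_T(X, N) = 0` for all finitely generated reflexive `X`, finitely generated `N` and `i ≥ 2`; equivalently
(`mem_cohomologyAnnihilatorOfDegree_add_three_iff_forall_reflexive 1`) iff `c` stably annihilates the FIRST
SYZYGY `ΩX` of every finitely generated reflexive `X`. [cite: IyengarTakahashi2014, Remark 2.13] -/
theorem mem_cohomologyAnnihilatorOfDegree_four_iff_forall_reflexive [IsDomain T] [IsNoetherianRing T]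
    (c : T) :
    c ∈ cohomologyAnnihilatorOfDegree T 4 ↔
      ∀ X : ModuleCat.{u} T, Module.Finite T X → Module.IsReflexive T X →
        ∀ N : ModuleCat.{u} T, Module.Finite T N →
          ∀ i : ℕ, 2 ≤ i → ∀ e : Ext.{u} X N i, c • e = 0 :=
  mem_cohomologyAnnihilatorOfDegree_add_three_iff_forall_reflexive_ext 1 c

/-! ## `Sat₄` criteria in reflexive language -/

/-- **`Sat₄` from the retract property of first syzygies of reflexive modules.**  Over a noetherian domain `T`:
if every first syzygy module `K = ΩX` of every finitely generated reflexive `X` is a retract of a second syzygy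
module `K' = Ω²X'` of some finitely generated reflexive `X'`, then `caᵐ(T) = ca⁴(T)` for every `m ≥ 4`
(the one-level retract criterion `(SC₃)` of `RecurrenceExclusion`, with `Ω³(mod T) = Ω(Ref T)` and
`Ω⁴(mod T) = Ω²(Ref T)`). [folklore] -/
theorem cohomologyAnnihilatorOfDegree_eq_four_of_forall_reflexive_syzygy_retract [IsDomain T]
    [IsNoetherianRing T]
    (h : ∀ (X K : ModuleCat.{u} T), Module.Finite T X → Module.IsReflexive T X → IsSyzygy 1 X K →
      ∃ (X' K' : ModuleCat.{u} T) (i : K ⟶ K') (r : K' ⟶ K),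
        Module.Finite T X' ∧ Module.IsReflexive T X' ∧ IsSyzygy 2 X' K' ∧ i ≫ r = 𝟙 K)
    {m : ℕ} (hm : 4 ≤ m) :
    cohomologyAnnihilatorOfDegree T m = cohomologyAnnihilatorOfDegree T 4 := by
  refine cohomologyAnnihilatorOfDegree_eq_of_forall_isSyzygy_retract_at 3 (fun M K hM hK => ?_) hm
  obtain ⟨X, hX, hXr, -, hK1⟩ := exists_reflexive_of_isSyzygy_add_two (n := 1) hM hK
  obtain ⟨X', K', i, r, hX', hX'r, hK', hir⟩ := h X K hX hXr hK1
  haveI := hX'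
  haveI := hX'r
  obtain ⟨M', hM', hK'4⟩ := exists_isSyzygy_add_two_of_isReflexive (n := 2) hK'
  exact ⟨M', K', i, r, hM', hK'4, hir⟩

/-- **`Sat₄` from the retract property of first syzygies of reflexive modules**, unlevelled: under the
hypothesis of `cohomologyAnnihilatorOfDegree_eq_four_of_forall_reflexive_syzygy_retract`, `ca(T) = ca⁴(T)`.
[folklore] -/
theorem cohomologyAnnihilator_eq_four_of_forall_reflexive_syzygy_retract [IsDomain T] [IsNoetherianRing T]
    (h : ∀ (X K : ModuleCat.{u} T), Module.Finite T X → Module.IsReflexive T X → IsSyzygy 1 X K →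
      ∃ (X' K' : ModuleCat.{u} T) (i : K ⟶ K') (r : K' ⟶ K),
        Module.Finite T X' ∧ Module.IsReflexive T X' ∧ IsSyzygy 2 X' K' ∧ i ≫ r = 𝟙 K) :
    cohomologyAnnihilator T = cohomologyAnnihilatorOfDegree T 4 := by
  refine cohomologyAnnihilator_eq_of_forall_isSyzygy_retract_at 3 (fun M K hM hK => ?_)
  obtain ⟨X, hX, hXr, -, hK1⟩ := exists_reflexive_of_isSyzygy_add_two (n := 1) hM hK
  obtain ⟨X', K', i, r, hX', hX'r, hK', hir⟩ := h X K hX hXr hK1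
  haveI := hX'
  haveI := hX'r
  obtain ⟨M', hM', hK'4⟩ := exists_isSyzygy_add_two_of_isReflexive (n := 2) hK'
  exact ⟨M', K', i, r, hM', hK'4, hir⟩

/-- **The SPECIAL-CLASS DOOR for `Sat₄`.**  Over a noetherian domain `T`, let `𝒮` be any class of
`T`-modules such that (i) members are finitely generated, (ii) every member is a retract of a FIRST syzygy module
of a member («`𝒮 ⊆ add Ω𝒮`»), and (iii) every first syzygy module of every finitely generated reflexive module is
a retract of a member («`Ω Ref ⊆ add 𝒮`»).  Then `ca(T) = ca⁴(T)`.  Proof: a third syzygy `Ω³M = Ω(Ω²M)` is a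
first syzygy of a reflexive module, hence a retract of some `S ∈ 𝒮`, which by recurrence
(`RecurrenceExclusion.exists_retract_isSyzygy_of_recurrent`) is a retract of a FOURTH syzygy module of a member;
so `(SC₃)` holds.  (Motivating instance, not used: at a rational surface singularity, `𝒮` = special
Cohen–Macaulay modules.) [folklore] -/
theorem cohomologyAnnihilator_eq_four_of_reflexiveSyzygyClass [IsDomain T] [IsNoetherianRing T]
    (𝒮 : ModuleCat.{u} T → Prop) (hfin : ∀ S, 𝒮 S → Module.Finite T S)
    (hrec : ∀ S, 𝒮 S → ∃ (S' N : ModuleCat.{u} T) (i : S ⟶ N) (r : N ⟶ S),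
      𝒮 S' ∧ IsSyzygy 1 S' N ∧ i ≫ r = 𝟙 S)
    (hΩ : ∀ (X K : ModuleCat.{u} T), Module.Finite T X → Module.IsReflexive T X → IsSyzygy 1 X K →
      ∃ (S : ModuleCat.{u} T) (i : K ⟶ S) (r : S ⟶ K), 𝒮 S ∧ i ≫ r = 𝟙 K) :
    cohomologyAnnihilator T = cohomologyAnnihilatorOfDegree T 4 := by
  refine cohomologyAnnihilator_eq_of_forall_isSyzygy_retract_at 3 (fun M K hM hK => ?_)
  obtain ⟨X, hX, hXr, -, hK1⟩ := exists_reflexive_of_isSyzygy_add_two (n := 1) hM hK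
  obtain ⟨S, i₀, r₀, hS, hir₀⟩ := hΩ X K hX hXr hK1
  obtain ⟨Y, N, i₁, r₁, hY, hN, hir₁⟩ := exists_retract_isSyzygy_of_recurrent 𝒮 hfin hrec 4 S hS
  refine ⟨Y, N, i₀ ≫ i₁, r₁ ≫ r₀, hfin Y hY, hN, ?_⟩
  rw [Category.assoc, ← Category.assoc i₁, hir₁, Category.id_comp, hir₀]

/-- The special-class door, levelled: under the same hypotheses `caᵐ(T) = ca⁴(T)` for every `m ≥ 4`.
[folklore] -/
theorem cohomologyAnnihilatorOfDegree_eq_four_of_reflexiveSyzygyClass [IsDomain T] [IsNoetherianRing T]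
    (𝒮 : ModuleCat.{u} T → Prop) (hfin : ∀ S, 𝒮 S → Module.Finite T S)
    (hrec : ∀ S, 𝒮 S → ∃ (S' N : ModuleCat.{u} T) (i : S ⟶ N) (r : N ⟶ S),
      𝒮 S' ∧ IsSyzygy 1 S' N ∧ i ≫ r = 𝟙 S)
    (hΩ : ∀ (X K : ModuleCat.{u} T), Module.Finite T X → Module.IsReflexive T X → IsSyzygy 1 X K →
      ∃ (S : ModuleCat.{u} T) (i : K ⟶ S) (r : S ⟶ K), 𝒮 S ∧ i ≫ r = 𝟙 K)
    {m : ℕ} (hm : 4 ≤ m) :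
    cohomologyAnnihilatorOfDegree T m = cohomologyAnnihilatorOfDegree T 4 := by
  refine cohomologyAnnihilatorOfDegree_eq_of_forall_isSyzygy_retract_at 3 (fun M K hM hK => ?_) hm
  obtain ⟨X, hX, hXr, -, hK1⟩ := exists_reflexive_of_isSyzygy_add_two (n := 1) hM hK
  obtain ⟨S, i₀, r₀, hS, hir₀⟩ := hΩ X K hX hXr hK1
  obtain ⟨Y, N, i₁, r₁, hY, hN, hir₁⟩ := exists_retract_isSyzygy_of_recurrent 𝒮 hfin hrec 4 S hS
  refine ⟨Y, N, i₀ ≫ i₁, r₁ ≫ r₀, hfin Y hY, hN, ?_⟩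
  rw [Category.assoc, ← Category.assoc i₁, hir₁, Category.id_comp, hir₀]

/-! ## Route vocabulary: the `m`-th conjunct of `SaturationFourSurfaceResidual₄` in reflexive language -/

section Route

variable {k K : Type u} [Field k] [Field K] [Algebra k K]

/-- **Converse route adapter** (to `PeriodicSaturationStage.ca_subset_caAt_of_le`): for a subalgebra stage
`T ⊆ K`, if the INLINE sets of the route file satisfy `ca T ⊆ caAt n T` (written out verbatim as in
`SaturationFourSurfaceResidual₄` / `Theses.HomologicalConductor.PersistenceSurface`), then
`ca(↥T) ≤ caⁿ(↥T)` as ideals of `↥T`. [OURS] -/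
theorem le_cohomologyAnnihilatorOfDegree_of_ca_subset_caAt (T : Subalgebra k K) {n : ℕ}
    (h : {x : K | ∃ hx : x ∈ T, ∃ m : ℕ, ∀ i : ℕ, m ≤ i → ∀ (M N : ModuleCat.{u} ↥T),
        Module.Finite ↥T M → Module.Finite ↥T N →
          ∀ e : CategoryTheory.Abelian.Ext.{u} M N i, (⟨x, hx⟩ : ↥T) • e = 0} ⊆
      {x : K | ∃ hx : x ∈ T, ∀ i : ℕ, n ≤ i → ∀ (M N : ModuleCat.{u} ↥T),
        Module.Finite ↥T M → Module.Finite ↥T N →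
          ∀ e : CategoryTheory.Abelian.Ext.{u} M N i, (⟨x, hx⟩ : ↥T) • e = 0}) :
    cohomologyAnnihilator ↥T ≤ cohomologyAnnihilatorOfDegree ↥T n := by
  intro c hc
  obtain ⟨m, hm⟩ := mem_cohomologyAnnihilator_iff'.mp hc
  have hcK : (c : K) ∈ {x : K | ∃ hx : x ∈ T, ∃ m : ℕ, ∀ i : ℕ, m ≤ i → ∀ (M N : ModuleCat.{u} ↥T),
      Module.Finite ↥T M → Module.Finite ↥T N →
        ∀ e : CategoryTheory.Abelian.Ext.{u} M N i, (⟨x, hx⟩ : ↥T) • e = 0} :=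
    ⟨c.2, m, fun i hi M N hM hN e => hm i hi M N hM hN e⟩
  obtain ⟨hx, hn⟩ := h hcK
  exact mem_cohomologyAnnihilatorOfDegree_iff.mpr fun i hi M N hM hN e => hn i hi M N hM hN e

/-- **Stub C1 at one stage, in reflexive language.**  For a subalgebra stage `T ⊆ K` with `↥T` noetherian (every
tower stage: `NoZeno.Birth.stub_towerNoetherian`; `↥T` is a domain as a subring of the field `K`), the `m`-th
conjunct `ca T ⊆ caAt 4 T` of `SaturationFourSurfaceResidual₄` (inline sets verbatim) holds IF AND ONLY IF every
`c ∈ ca(↥T)` kills `Extⁱ_{↥T}(X, N)` for all finitely generated reflexive `X`, finitely generated `N` and `i ≥ 2`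
(`=` stably annihilates `ΩX` for every finitely generated reflexive `X`,
`mem_cohomologyAnnihilatorOfDegree_add_three_iff_forall_reflexive 1`).  At a normal surface stage the finitely
generated reflexive modules are the maximal Cohen–Macaulay modules. [OURS] -/
theorem ca_subset_caAt_four_iff_forall_reflexive (T : Subalgebra k K) [IsNoetherianRing ↥T] :
    ({x : K | ∃ hx : x ∈ T, ∃ m : ℕ, ∀ i : ℕ, m ≤ i → ∀ (M N : ModuleCat.{u} ↥T),
        Module.Finite ↥T M → Module.Finite ↥T N →
          ∀ e : CategoryTheory.Abelian.Ext.{u} M N i, (⟨x, hx⟩ : ↥T) • e = 0} ⊆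
      {x : K | ∃ hx : x ∈ T, ∀ i : ℕ, 4 ≤ i → ∀ (M N : ModuleCat.{u} ↥T),
        Module.Finite ↥T M → Module.Finite ↥T N →
          ∀ e : CategoryTheory.Abelian.Ext.{u} M N i, (⟨x, hx⟩ : ↥T) • e = 0}) ↔
      ∀ c : ↥T, c ∈ cohomologyAnnihilator ↥T →
        ∀ X : ModuleCat.{u} ↥T, Module.Finite ↥T X → Module.IsReflexive ↥T X →
          ∀ N : ModuleCat.{u} ↥T, Module.Finite ↥T N →
            ∀ i : ℕ, 2 ≤ i → ∀ e : Ext.{u} X N i, c • e = 0 := by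
  constructor
  · intro h c hc
    exact (mem_cohomologyAnnihilatorOfDegree_four_iff_forall_reflexive c).mp
      (le_cohomologyAnnihilatorOfDegree_of_ca_subset_caAt T h hc)
  · intro h
    exact ca_subset_caAt_of_le T fun c hc =>
      (mem_cohomologyAnnihilatorOfDegree_four_iff_forall_reflexive c).mpr (h c hc)

/-- **The special-class door in ROUTE VOCABULARY**: for a subalgebra stage `T ⊆ K` with `↥T` noetherian, a class
`𝒮` of finitely generated `↥T`-modules with `𝒮 ⊆ add Ω𝒮` and `Ω Ref(↥T) ⊆ add 𝒮`
(`cohomologyAnnihilator_eq_four_of_reflexiveSyzygyClass`) gives the `m`-th conjunct `ca T ⊆ caAt 4 T` of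
`SaturationFourSurfaceResidual₄` at that stage (inline sets verbatim). [OURS] -/
theorem ca_subset_caAt_four_of_reflexiveSyzygyClass (T : Subalgebra k K) [IsNoetherianRing ↥T]
    (𝒮 : ModuleCat.{u} ↥T → Prop) (hfin : ∀ S, 𝒮 S → Module.Finite ↥T S)
    (hrec : ∀ S, 𝒮 S → ∃ (S' N : ModuleCat.{u} ↥T) (i : S ⟶ N) (r : N ⟶ S),
      𝒮 S' ∧ IsSyzygy 1 S' N ∧ i ≫ r = 𝟙 S)
    (hΩ : ∀ (X L : ModuleCat.{u} ↥T), Module.Finite ↥T X → Module.IsReflexive ↥T X → IsSyzygy 1 X L →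
      ∃ (S : ModuleCat.{u} ↥T) (i : L ⟶ S) (r : S ⟶ L), 𝒮 S ∧ i ≫ r = 𝟙 L) :
    {x : K | ∃ hx : x ∈ T, ∃ m : ℕ, ∀ i : ℕ, m ≤ i → ∀ (M N : ModuleCat.{u} ↥T),
        Module.Finite ↥T M → Module.Finite ↥T N →
          ∀ e : CategoryTheory.Abelian.Ext.{u} M N i, (⟨x, hx⟩ : ↥T) • e = 0} ⊆
      {x : K | ∃ hx : x ∈ T, ∀ i : ℕ, 4 ≤ i → ∀ (M N : ModuleCat.{u} ↥T),
        Module.Finite ↥T M → Module.Finite ↥T N →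
          ∀ e : CategoryTheory.Abelian.Ext.{u} M N i, (⟨x, hx⟩ : ↥T) • e = 0} :=
  ca_subset_caAt_of_le T (cohomologyAnnihilator_eq_four_of_reflexiveSyzygyClass 𝒮 hfin hrec hΩ).le

end Route

end Summit.ResolutionOfSingularities.ResolutionOfSingularities.Theorems.HomologicalConductor.PersistenceSurfaceSaturationReflexiveSyzygy

end
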